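import Summits.Ventures.DiscreteObjects.Hadamard.NormalizerPrimeMain
import Summits.Ventures.DiscreteObjects.Hadamard.Frobenius23Row
import Summits.Ventures.DiscreteObjects.Hadamard.FixedSubmatrix23

/-!
# H(668): a block-preserving automorphism normalising an element of order 23 acts on it as `±1` (kernel EXCLUSION)

Framing: lottery ticket; floor = certified bounds/negative ranges.

Cell pub-namedobj (venture DiscreteObjects), target (H), hadamard gen 20; the order-23 instance of `NormalizerPrimeMain`.  Let
`σ = (π, κ, d, e)` be a signed automorphism of a Hadamard matrix of order `668` with `π^23 = κ^23 = 1`, `(π, κ) ≠ (1,1)` (census gen 6,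
`hadamard668_fixedRows_23`: `1 + 1` fixed points and `29 + 29` orbits, or `24 + 24` fixed points and `28 + 28` orbits) and
`τ = (π', κ', d', e')` a signed automorphism with `π'π = π^μ π'`, `κ'κ = κ^μ κ'` keeping a free row `x₀` and every free column inside
its `σ`-orbit.  Then (**`hadamard668_order23_normalizer_sq_eq_one`**) **`μ² ≡ 1 (mod 23)`**.  [`normalizing_prime_main`: the `29` (resp.
`28`) `±1` sequences of `x₀` have `Σ PAF = −1` (resp. `−24`) off `0` and are twisted `μ`-invariant; if `μ² ≢ 1` recentre
(`exists_translate_hInvariant_prime`), then each is invariant under `μ²`, a generator of the squares `C₁₁ = ⟨4⟩` (`inv4_of_hInvariant23`,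
orbit table of `Frobenius23Row`), hence a three-valued block with `PAF(1) ∈ {−1, 19, 23}` (`paf_blk23_pm_one`, `decide`); with
`t_y = PAF + 1 ∈ {0, 20, 24}` the sums `Σ t_y = 28` resp. `4` are impossible (two non-zero terms already give `≥ 40`).]  Unlike
`167` and `83` there is NO general (block-permuting) version by the `|T|!` trick: `S₂₉` contains elements of order `11`.  Gen 4's
design-level rows `Z₂₃ ⋊ Z₁₁`, `Z₂₃ ⋊ Z₂₂` (`no_frobenius23_row`, orbit lengths {1,23}, no fixed point at design level) are the
`1 + 1` case; the `24 + 24` case is new.  EXCLUSION of a symmetry type of a hypothetical object; no order excluded; H(668) untouched;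
HITS 0/4.  Ours; no `sorry`, no definitions.
-/

namespace Summit.Ventures.DiscreteObjects.Hadamard

open Finset BigOperators Matrix

open Literature.Combinatorics.Designs.GoethalsSeidel (IsHadamardMatrix)
open Literature.Combinatorics.Designs.LegendrePairs (PAF IsPM TwistedInvariant HInvariant PAF_translate)

variable {ι : Type*} [Fintype ι] [DecidableEq ι]

/-! ### number theory in `ZMod 23` -/

/-- `orb23 k = 4^k` -/
lemma orb23_eq_pow (k : ℕ) : orb23 k = 4 ^ k := by
  induction k with
  | zero => rfl
  | succ k ih => show 4 * orb23 k = _; rw [ih, pow_succ']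

set_option maxRecDepth 100000 in
/-- `4` has order dividing `11` in `(ℤ/23)ˣ` -/
lemma four_pow_11_zmod23 : (4 : ZMod 23) ^ 11 = 1 := by decide

/-- **a sequence on `ZMod 23` invariant under a unit `u` with `u² ≠ 1` is invariant under `4`** -/
theorem inv4_of_hInvariant23 {α : Type*} (x : ZMod 23 → α) (u : (ZMod 23)ˣ) (hsq : (u : ZMod 23) ^ 2 ≠ 1)
    (h : ∀ i, x ((u : ZMod 23) * i) = x i) : ∀ i, x (4 * i) = x i := by
  have h11 := four_pow_11_zmod23
  have hu0 : (u : ZMod 23) ≠ 0 := fun h0 => by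
    have h1 := u.mul_inv; rw [h0, zero_mul] at h1; exact absurd h1 (by decide)
  obtain ⟨j₀, hj₀⟩ : ∃ j : ℕ, (u : ZMod 23) = 4 ^ j ∨ (u : ZMod 23) = -(4 ^ j) := by
    rcases orbit_cover23 (u : ZMod 23) with h0 | ⟨-, he⟩ | ⟨-, he⟩
    · exact absurd h0 hu0
    · exact ⟨_, Or.inl (by rw [← he, orb23_eq_pow])⟩
    · exact ⟨_, Or.inr (by rw [← orb23_eq_pow, he, neg_neg])⟩
  have husq : (u : ZMod 23) ^ 2 = 4 ^ (2 * j₀) := by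
    rcases hj₀ with h1 | h1 <;> rw [h1] <;> ring
  have hj11 : ¬ 11 ∣ j₀ := by
    rintro ⟨q, rfl⟩
    apply hsq
    rw [husq, show 2 * (11 * q) = 11 * (2 * q) by ring, pow_mul, h11, one_pow]
  have hcop : Nat.Coprime (2 * j₀) 11 :=
    Nat.Coprime.mul_left (by norm_num) ((Nat.Prime.coprime_iff_not_dvd (by norm_num : Nat.Prime 11)).mpr hj11).symm
  obtain ⟨m, -, hm⟩ := Nat.exists_mul_mod_eq_one_of_coprime hcop (by norm_num : 1 < 11)
  have h2 : ∀ i, x ((u : ZMod 23) ^ 2 * i) = x i := fun i => by rw [sq, mul_assoc, h, h]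
  have hpow : ∀ k : ℕ, ∀ i, x (((u : ZMod 23) ^ 2) ^ k * i) = x i := by
    intro k; induction k with
    | zero => intro i; simp
    | succ k ih => intro i; rw [pow_succ, mul_assoc, ih, h2]
  have h4 : ((u : ZMod 23) ^ 2) ^ m = 4 := by
    have hdm := Nat.div_add_mod (2 * j₀ * m) 11
    rw [husq, ← pow_mul, show 2 * j₀ * m = 11 * (2 * j₀ * m / 11) + 1 by omega, pow_add, pow_mul, h11, one_pow,
      one_mul, pow_one]
  intro i
  rw [← h4]; exact hpow m i

set_option maxRecDepth 100000 in
set_option maxHeartbeats 4000000 in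
/-- the eight `±1` three-valued blocks on `ZMod 23` have `PAF(1) ∈ {−1, 19, 23}` (kernel evaluation) -/
theorem paf_blk23_pm_one : ∀ e0 ∈ [(1 : ℤ), -1], ∀ e1 ∈ [(1 : ℤ), -1], ∀ e2 ∈ [(1 : ℤ), -1],
    PAF (blk23 e0 e1 e2) 1 = -1 ∨ PAF (blk23 e0 e1 e2) 1 = 19 ∨ PAF (blk23 e0 e1 e2) 1 = 23 := by
  decide

/-- `PAF(1)` of a `4`-invariant `±1` sequence on `ZMod 23` is `−1`, `19` or `23` -/
theorem paf_one_of_inv4_23 (x : ZMod 23 → ℤ) (hx : IsPM x) (hinv : ∀ i, x (4 * i) = x i) :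
    PAF x 1 = -1 ∨ PAF x 1 = 19 ∨ PAF x 1 = 23 := by
  have mem : ∀ {e : ℤ}, (e = 1 ∨ e = -1) → e ∈ [(1 : ℤ), -1] := fun h => by rcases h with rfl | rfl <;> simp
  rw [eq_blk23 x hinv]
  exact paf_blk23_pm_one (x 0) (mem (hx 0)) (x 1) (mem (hx 1)) (x (-1)) (mem (hx (-1)))

omit [Fintype ι] in
/-- square-invariant `±1` sequences on `ZMod 23`: `Σ (PAF(1) + 1)` lies in `{0, 20, 24} ∪ [40, ∞)`, so it is neither `4` nor `28` -/
lemma sum_family_qr23 {T : Finset ι} (x : ι → ZMod 23 → ℤ) (hpm : ∀ y ∈ T, IsPM (x y))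
    (h4 : ∀ y ∈ T, ∀ i, x y (4 * i) = x y i) :
    ∑ y ∈ T, (PAF (x y) 1 + 1) ≠ 4 ∧ ∑ y ∈ T, (PAF (x y) 1 + 1) ≠ 28 := by
  have hval : ∀ y ∈ T, PAF (x y) 1 + 1 = 0 ∨ 20 ≤ PAF (x y) 1 + 1 := by
    intro y hy
    rcases paf_one_of_inv4_23 (x y) (hpm y hy) (h4 y hy) with h | h | h <;> rw [h] <;> norm_num
  have hle : ∀ y ∈ T, PAF (x y) 1 + 1 ≤ 24 := by
    intro y hy
    rcases paf_one_of_inv4_23 (x y) (hpm y hy) (h4 y hy) with h | h | h <;> rw [h] <;> norm_num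
  have hnn : ∀ y ∈ T, 0 ≤ PAF (x y) 1 + 1 := fun y hy => by rcases hval y hy with h | h <;> omega
  by_cases hex : ∃ y ∈ T, PAF (x y) 1 + 1 ≠ 0
  · obtain ⟨y₁, hy₁, hne₁⟩ := hex
    have h20 : 20 ≤ PAF (x y₁) 1 + 1 := by
      rcases hval y₁ hy₁ with h | h
      · exact absurd h hne₁
      · exact h
    rw [← Finset.add_sum_erase T _ hy₁]
    by_cases hex2 : ∃ y ∈ T.erase y₁, PAF (x y) 1 + 1 ≠ 0
    · obtain ⟨y₂, hy₂, hne₂⟩ := hex2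
      have hy₂T : y₂ ∈ T := Finset.mem_of_mem_erase hy₂
      have h20' : 20 ≤ PAF (x y₂) 1 + 1 := by
        rcases hval y₂ hy₂T with h | h
        · exact absurd h hne₂
        · exact h
      have := Finset.single_le_sum (fun y hy => hnn y (Finset.mem_of_mem_erase hy)) hy₂
      constructor <;> omega
    · push Not at hex2
      rw [Finset.sum_eq_zero hex2]
      have := hle y₁ hy₁
      constructor <;> omega
  · push Not at hex
    rw [Finset.sum_eq_zero hex]
    omega

section main
variable {H : Matrix ι ι ℤ}

/-- **EXCLUSION (order 23, block-preserving normalisers act as `±1`).**  `σ = (π, κ, d, e)` a signed automorphism of an H(668) with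
`π^23 = κ^23 = 1`, `(π, κ) ≠ (1,1)`; `τ` a signed automorphism with `π'π = π^μ π'`, `κ'κ = κ^μ κ'` keeping the free row `x₀` and every
free column inside its `σ`-orbit ⇒ **`μ² ≡ 1 (mod 23)`** — for both census types (`1 + 1` and `24 + 24` fixed points). -/
theorem hadamard668_order23_normalizer_sq_eq_one (hH : IsHadamardMatrix H) (hι : Fintype.card ι = 668)
    {π κ π' κ' : Equiv.Perm ι} {d e d' e' : ι → ℤ} (haut : IsSignedAut H π κ d e)
    (hπ : π ^ 23 = 1) (hκ : κ ^ 23 = 1) (hne : π ≠ 1 ∨ κ ≠ 1)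
    (haut' : IsSignedAut H π' κ' d' e') {μ : ℕ} (hnπ : π' * π = π ^ μ * π') (hnκ : κ' * κ = κ ^ μ * κ')
    {x₀ : ι} (hx₀ : π x₀ ≠ x₀) (hrow : π' x₀ ∈ orbFin π 23 x₀) (hcols : ∀ y, κ y ≠ y → κ' y ∈ orbFin κ 23 y) :
    (μ : ZMod 23) ^ 2 = 1 := by
  have h10 : (1 : ZMod 23) ≠ 0 := by decide
  by_contra hsq
  obtain ⟨u, T, x, hu, hTc, hpm, hgs, htw⟩ := normalizing_prime_main (by norm_num : Nat.Prime 23) (by decide : Odd 23)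
    hH haut hπ hκ hne haut' hnπ hnκ hx₀ hrow hcols
  have hsplit := Finset.card_filter_add_card_filter_not (s := (univ : Finset ι)) (fun y => κ y = y)
  rw [Finset.card_univ, hι] at hsplit
  rw [← hu] at hsq
  have hu1 : (u : ZMod 23) ≠ 1 := fun h => hsq (by rw [h, one_pow])
  haveI : Fact (Nat.Prime 23) := ⟨by norm_num⟩
  have hrec : ∀ y ∈ T, ∃ δ : ZMod 23, HInvariant (Literature.Combinatorics.Designs.LegendrePairs.translate (x y) δ) u :=
    fun y hy => exists_translate_hInvariant_prime (x y) u hu1 (htw y hy)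
  choose! δ hδ using hrec
  set x' : ι → ZMod 23 → ℤ := fun y => Literature.Combinatorics.Designs.LegendrePairs.translate (x y) (δ y) with hx'
  have hpm' : ∀ y ∈ T, IsPM (x' y) := fun y hy r => hpm y hy _
  have h4' : ∀ y ∈ T, ∀ i, x' y (4 * i) = x' y i := fun y hy => inv4_of_hInvariant23 _ u hsq (hδ y hy)
  have hgs' : ∑ y ∈ T, PAF (x' y) 1 = -((univ.filter fun y => κ y = y).card : ℤ) := by
    rw [Finset.sum_congr rfl fun y _ => PAF_translate (x y) (δ y) 1]; exact hgs 1 h10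
  have hsum1 : ∑ y ∈ T, (PAF (x' y) 1 + 1) = -((univ.filter fun y => κ y = y).card : ℤ) + T.card := by
    rw [Finset.sum_add_distrib, hgs', Finset.sum_const]; simp
  obtain ⟨h4ne, h28ne⟩ := sum_family_qr23 x' hpm' h4'
  rcases hadamard668_fixedRows_23 hH hι π κ d e haut hπ hκ hne with ⟨-, hc1⟩ | ⟨-, hc24⟩
  · -- 1 fixed column: |T| = 29, Σ (PAF + 1) = 28
    rw [hc1] at hsplit hsum1
    have hm : (univ.filter fun y => ¬ κ y = y).card = 667 := by omega
    have hm' : (univ.filter fun y => κ y ≠ y).card = 667 := hm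
    rw [hm'] at hTc
    have hT29 : T.card = 29 := by omega
    rw [hT29] at hsum1
    exact h28ne (by rw [hsum1]; norm_num)
  · -- 24 fixed columns: |T| = 28, Σ (PAF + 1) = 4
    rw [hc24] at hsplit hsum1
    have hm : (univ.filter fun y => ¬ κ y = y).card = 644 := by omega
    have hm' : (univ.filter fun y => κ y ≠ y).card = 644 := hm
    rw [hm'] at hTc
    have hT28 : T.card = 28 := by omega
    rw [hT28] at hsum1
    exact h4ne (by rw [hsum1]; norm_num)

end main

end Summit.Ventures.DiscreteObjects.Hadamard
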